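import Literature.AlgebraicGeometry.Resolution.DerivativeIdealsLocalization
import Literature.AlgebraicGeometry.Resolution.MarkedIdeals
import Mathlib.RingTheory.Extension.Cotangent.Basic
import Mathlib.AlgebraicGeometry.Morphisms.FinitePresentation
import HarnessLib

/-!
# The derivative ideal sheaves `𝒟ⁱ(𝓘)` of an ideal sheaf on a `k`-scheme

Topic: `Literature/AlgebraicGeometry/Resolution`. Bierstone–Grigoriev–Milman–Włodarczyk,
*Effective Hironaka resolution and its complexity*, arXiv:1206.3090, **Def. 3.5.1** (after
Giraud, Villamayor, Bierstone–Milman, Encinas–Villamayor, Włodarczyk, Kollár): for a coherent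
ideal sheaf `𝓘` on a smooth variety `X` over `K`, "the *first derivative* … `𝒟(𝓘)` [is] the
coherent sheaf of ideals generated by all functions `f ∈ 𝓘` together with their first
derivatives", "`𝒟ⁱ(𝓘) := 𝒟(𝒟^{i-1}(𝓘))`", "`𝒟ⁱ(𝓘, μ) := (𝒟ⁱ(𝓘), μ - i)`"; and the
characteristic-free half of **Lemma 3.5.2**: `supp(𝓘, μ) ⊆ supp(𝒟ⁱ(𝓘), μ - i)`.

Here `X` is any scheme with a **`k`-structure** `φ : k →+* Γ(X, 𝒪_X)` (equivalently a morphism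
`X → Spec k`; `overHom` for `[X.Over (Spec k)]`), which makes every `Γ(X, U)` and every stalk
`𝒪_{X,x}` a `k`-algebra (`sectionsAlgebra`, `stalkAlgebra`), and `𝒟` is the ring-level
derivative ideal `derivIdeal k` of `DerivativeIdeals.lean` (all `k`-derivations `Γ(X,U) → Γ(X,U)`;
on a smooth variety these are the local combinations of the `∂/∂uᵢ`, BGMW §3.5).

* `derivIdealSheaf φ 𝓘` — **`𝒟(𝓘)`**, the largest quasi-coherent ideal sheaf whose sections on
  each affine open `U` lie in `𝒟(𝓘(U))` (`Scheme.IdealSheafData.ofIdeals`, as for kernels in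
  Mathlib); `derivIdealSheafIter φ i 𝓘` — **`𝒟ⁱ(𝓘)`**; `MarkedIdeal.deriv` — **`𝒟ⁱ(𝓘, μ)`**;
* `HasFinitePresentationDifferentials φ` — the Kähler differentials `Ω[Γ(X,U)⁄k]` of the affine
  pieces are finitely presented; implied by `X` locally of finite presentation over `k`
  (`hasFinitePresentationDifferentials_of_finitePresentation`, `…_overHom`; BGMW: `X` a smooth
  variety). Under this hypothesis `𝒟` **commutes with localization**
  (`DerivativeIdealsLocalization.lean`), whence:
* `derivIdealSheaf_ideal` — **`𝒟(𝓘)(U) = 𝒟(𝓘(U))`** on affine opens (the family is already an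
  ideal sheaf); `derivIdealSheafIter_ideal` — `𝒟ⁱ(𝓘)(U) = 𝒟ⁱ(𝓘(U))`;
* `stalkIdeal_derivIdealSheaf` — **`𝒟(𝓘)_x = 𝒟(𝓘_x)`** (derivative ideal of the stalk in the
  `k`-algebra `𝒪_{X,x}`); `stalkIdeal_derivIdealSheafIter`;
* `stalkIdeal_derivIdealSheafIter_le_pow`, `MarkedIdeal.support_subset_support_deriv` — **BGMW
  Lemma 3.5.2, inclusion `⊆`** (every characteristic): `ord_x 𝓘 ≥ μ ⇒ ord_x 𝒟ⁱ(𝓘) ≥ μ - i`,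
  i.e. `supp(𝓘, μ) ⊆ supp(𝒟ⁱ(𝓘), μ - i)` (Leibniz: `δ(𝔪ⁿ) ⊆ 𝔪ⁿ⁻¹`). The reverse inclusion
  needs `μ ≤ i + ord` and `1, …, μ` invertible (BGMW Thm. 8.0.4: multiplicity `< p`) and regular
  points; its polynomial-ring form is `DerivativeIdealsOrder.lean`.
* unconditionally: `le_derivIdealSheaf` (`𝓘 ⊆ 𝒟(𝓘)`), `derivIdealSheaf_mono`, `derivIdealSheaf_top`.

## Sources

* [BGMW 2011] Def. 3.5.1, Lemma 3.5.2 (p. 7, arXiv numbering); Thm. 8.0.4.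
  [BierstoneGrigorievMilmanWlodarczyk2011]
-/

namespace Literature.AlgebraicGeometry.Resolution

open CategoryTheory _root_.AlgebraicGeometry TopologicalSpace IsLocalRing Opposite

universe u v

section KStructure

variable {k : Type v} [CommRing k] {X : Scheme.{u}} (φ : k →+* Γ(X, ⊤))

/-! ## `k`-structures on sections and stalks -/

/-- The `k`-algebra structure `k → Γ(X, 𝒪_X) → Γ(X, U)` on the sections over `U` of a scheme with
`k`-structure `φ`. [folklore] -/
def sectionsHom (U : X.Opens) : k →+* Γ(X, U) :=
  (X.presheaf.map (homOfLE le_top).op).hom.comp φ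

/-- `Γ(X, U)` as a `k`-algebra (activate with `letI := sectionsAlgebra φ U`). [folklore] -/
abbrev sectionsAlgebra (U : X.Opens) : Algebra k Γ(X, U) :=
  (sectionsHom φ U).toAlgebra

/-- Restriction maps are `k`-algebra maps. [folklore] -/
theorem map_comp_sectionsHom {U V : X.Opens} (h : V ≤ U) :
    (X.presheaf.map (homOfLE h).op).hom.comp (sectionsHom φ U) = sectionsHom φ V := by
  unfold sectionsHom
  rw [← RingHom.comp_assoc, ← CommRingCat.hom_comp, ← X.presheaf.map_comp]
  rfl

/-- On global sections the `k`-structure is `φ` itself. [folklore] -/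
theorem sectionsHom_top : sectionsHom φ ⊤ = φ := by
  unfold sectionsHom
  have : (homOfLE (le_top : (⊤ : X.Opens) ≤ ⊤)).op = 𝟙 _ := rfl
  rw [this, X.presheaf.map_id]
  rfl

/-- The `k`-algebra structure `k → Γ(X, 𝒪_X) → 𝒪_{X,x}` on the stalks. [folklore] -/
noncomputable def stalkHom (x : X) : k →+* X.presheaf.stalk x :=
  (X.presheaf.germ ⊤ x trivial).hom.comp φ

/-- `𝒪_{X,x}` as a `k`-algebra (activate with `letI := stalkAlgebra φ x`). [folklore] -/
noncomputable abbrev stalkAlgebra (x : X) : Algebra k (X.presheaf.stalk x) :=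
  (stalkHom φ x).toAlgebra

/-- Germ maps are `k`-algebra maps. [folklore] -/
theorem germ_comp_sectionsHom (U : X.Opens) (x : X) (hx : x ∈ U) :
    (X.presheaf.germ U x hx).hom.comp (sectionsHom φ U) = stalkHom φ x := by
  unfold sectionsHom stalkHom
  rw [← RingHom.comp_assoc, ← CommRingCat.hom_comp,
    TopCat.Presheaf.germ_res X.presheaf (homOfLE (le_top : U ≤ ⊤)) x hx]

/-- **Finiteness hypothesis** (a predicate on the `k`-structure `φ`, consumed downstream as an
explicit hypothesis `(hX : HasFinitePresentationDifferentials φ)`): the Kähler differentials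
`Ω[Γ(X,U)⁄k]` of every affine piece are a finitely presented `Γ(X, U)`-module. True when `X` is
locally of finite presentation over `k`, in particular for varieties
(`hasFinitePresentationDifferentials_of_finitePresentation`,
`hasFinitePresentationDifferentials_overHom`); **not** automatic — it fails for
`Spec k[xᵢ : i ∈ ℕ]` (`not_forall_hasFinitePresentationDifferentials` in
`DerivativeIdealSheafHypothesis.lean`), so there is no unconditional `_holds` theorem. [folklore] -/
def HasFinitePresentationDifferentials (φ : k →+* Γ(X, ⊤)) : Prop :=
  ∀ U : X.affineOpens,
    letI := sectionsAlgebra φ U; Module.FinitePresentation Γ(X, U) Ω[Γ(X, U)⁄k]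

/-- Schemes locally of finite presentation over `k` have finitely presented differentials.
[folklore] -/
theorem hasFinitePresentationDifferentials_of_finitePresentation
    (h : ∀ U : X.affineOpens, (sectionsHom φ U).FinitePresentation) :
    HasFinitePresentationDifferentials φ := by
  intro U
  letI := sectionsAlgebra φ U
  haveI : Algebra.FinitePresentation k Γ(X, U) := h U
  infer_instance

end KStructure

/-! ## The `k`-structure of a scheme over `Spec k` -/

section Over

variable (k : Type u) [CommRing k] (X : Scheme.{u}) [X.Over (Spec (.of k))]

/-- The `k`-structure `k ≅ Γ(Spec k, 𝒪) → Γ(X, 𝒪_X)` of a scheme over `Spec k`. [folklore] -/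
noncomputable def overHom : k →+* Γ(X, ⊤) :=
  ((X ↘ Spec (.of k)).appTop).hom.comp (Scheme.ΓSpecIso (.of k)).inv.hom

/-- For `X` locally of finite presentation over `Spec k`, every affine piece `Γ(X, U)` is a
finitely presented `k`-algebra. [folklore] -/
theorem finitePresentation_sectionsHom_overHom
    [LocallyOfFinitePresentation (X ↘ Spec (.of k))] (U : X.affineOpens) :
    (sectionsHom (overHom k X) U).FinitePresentation := by
  have h := HasRingHomProperty.appLE (P := @LocallyOfFinitePresentation)
    (f := X ↘ Spec (.of k)) inferInstance ⟨⊤, isAffineOpen_top _⟩ U le_top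
  have h' := (RingHom.finitePresentation_respectsIso.cancel_left_isIso
    (Scheme.ΓSpecIso (.of k)).inv ((X ↘ Spec (.of k)).appLE ⊤ U le_top)).mpr h
  exact h'

/-- Hence `X` locally of finite presentation over `Spec k` has finitely presented differentials.
[folklore] -/
theorem hasFinitePresentationDifferentials_overHom
    [LocallyOfFinitePresentation (X ↘ Spec (.of k))] :
    HasFinitePresentationDifferentials (overHom k X) :=
  hasFinitePresentationDifferentials_of_finitePresentation _
    (finitePresentation_sectionsHom_overHom k X)

end Over

section Sheaf

variable {k : Type v} [CommRing k] {X : Scheme.{u}} (φ : k →+* Γ(X, ⊤))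

/-! ## The derivative ideal sheaf -/

/-- The family of derivative ideals `U ↦ 𝒟(𝓘(U))` on affine opens.
[cite: BierstoneGrigorievMilmanWlodarczyk2011, Def. 3.5.1] -/
def derivIdeals (I : X.IdealSheafData) (U : X.affineOpens) : Ideal Γ(X, U) :=
  letI := sectionsAlgebra φ U; derivIdeal k (I.ideal U)

/-- **The derivative ideal sheaf `𝒟(𝓘)`** (BGMW Def. 3.5.1): the largest quasi-coherent ideal
sheaf with `𝒟(𝓘)(U) ⊆ 𝒟(𝓘(U))` for all affine opens `U` — equal to `𝒟(𝓘(U))` as soon as the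
differentials are finitely presented (`derivIdealSheaf_ideal`), e.g. on a variety.
[cite: BierstoneGrigorievMilmanWlodarczyk2011, Def. 3.5.1] -/
def derivIdealSheaf (I : X.IdealSheafData) : X.IdealSheafData :=
  Scheme.IdealSheafData.ofIdeals (derivIdeals φ I)

/-- `𝓘 ⊆ 𝒟(𝓘)`. [cite: BierstoneGrigorievMilmanWlodarczyk2011, Def. 3.5.1] -/
theorem le_derivIdealSheaf (I : X.IdealSheafData) : I ≤ derivIdealSheaf φ I :=
  Scheme.IdealSheafData.le_ofIdeals_iff.mpr fun U => by
    letI := sectionsAlgebra φ U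
    exact le_derivIdeal k (I.ideal U)

/-- `𝒟` is monotone. [folklore] -/
theorem derivIdealSheaf_mono {I J : X.IdealSheafData} (h : I ≤ J) :
    derivIdealSheaf φ I ≤ derivIdealSheaf φ J :=
  Scheme.IdealSheafData.ofIdeals_mono fun U => by
    letI := sectionsAlgebra φ U
    exact derivIdeal_mono k (h U)

/-- `𝒟(𝒪_X) = 𝒪_X`. [folklore] -/
theorem derivIdealSheaf_top : derivIdealSheaf φ (⊤ : X.IdealSheafData) = ⊤ :=
  top_le_iff.mp (le_derivIdealSheaf φ ⊤)

/-- `supp 𝒟(𝓘) ⊆ supp 𝓘` (as closed sets `V(·)`). [folklore] -/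
theorem support_derivIdealSheaf_le (I : X.IdealSheafData) :
    (derivIdealSheaf φ I).support ≤ I.support :=
  Scheme.IdealSheafData.support_antitone (le_derivIdealSheaf φ I)

variable {φ}

/-- With finitely presented differentials, **the family `U ↦ 𝒟(𝓘(U))` is compatible with
restriction to basic opens** (`𝒟` commutes with the localization `Γ(X, U) → Γ(X, D(f))`).
[cite: BierstoneGrigorievMilmanWlodarczyk2011, Def. 3.5.1] -/
theorem derivIdeals_map_basicOpen (hX : HasFinitePresentationDifferentials φ)
    (I : X.IdealSheafData) (U : X.affineOpens) (f : Γ(X, U)) :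
    (derivIdeals φ I U).map (X.presheaf.map (homOfLE <| X.basicOpen_le f).op).hom =
      derivIdeals φ I (X.affineBasicOpen f) := by
  letI := sectionsAlgebra φ U
  letI : Algebra k Γ(X, X.basicOpen f) := sectionsAlgebra φ (X.basicOpen f)
  haveI : IsScalarTower k Γ(X, U) Γ(X, X.basicOpen f) :=
    IsScalarTower.of_algebraMap_eq fun c =>
      (RingHom.congr_fun (map_comp_sectionsHom φ (X.basicOpen_le f)) c).symm
  haveI := U.2.isLocalization_basicOpen f
  haveI := hX U
  unfold derivIdeals
  rw [← I.map_ideal_basicOpen]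
  exact (derivIdeal_map_of_isLocalization k Γ(X, X.basicOpen f) (Submonoid.powers f)
    (I.ideal U)).symm

/-- The ideal sheaf datum `U ↦ 𝒟(𝓘(U))` (finitely presented differentials). [folklore] -/
def derivIdealSheafData (hX : HasFinitePresentationDifferentials φ) (I : X.IdealSheafData) :
    X.IdealSheafData where
  ideal := derivIdeals φ I
  map_ideal_basicOpen := derivIdeals_map_basicOpen hX I

/-- `𝒟(𝓘)` is the datum `U ↦ 𝒟(𝓘(U))`. [folklore] -/
theorem derivIdealSheaf_eq (hX : HasFinitePresentationDifferentials φ) (I : X.IdealSheafData) :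
    derivIdealSheaf φ I = derivIdealSheafData hX I :=
  Scheme.IdealSheafData.ofIdeals_ideal (derivIdealSheafData hX I)

/-- **Sections of `𝒟(𝓘)`**: `𝒟(𝓘)(U) = 𝒟(𝓘(U))` for affine `U` (finitely presented
differentials). [cite: BierstoneGrigorievMilmanWlodarczyk2011, Def. 3.5.1] -/
theorem derivIdealSheaf_ideal (hX : HasFinitePresentationDifferentials φ) (I : X.IdealSheafData)
    (U : X.affineOpens) :
    (derivIdealSheaf φ I).ideal U = (letI := sectionsAlgebra φ U; derivIdeal k (I.ideal U)) := by
  rw [derivIdealSheaf_eq hX]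
  rfl

variable (φ)

/-- **The higher derivative ideal sheaves `𝒟ⁱ(𝓘) := 𝒟(𝒟^{i-1}(𝓘))`** (BGMW Def. 3.5.1).
[cite: BierstoneGrigorievMilmanWlodarczyk2011, Def. 3.5.1] -/
def derivIdealSheafIter (i : ℕ) (I : X.IdealSheafData) : X.IdealSheafData :=
  (derivIdealSheaf φ)^[i] I

/-- `𝒟⁰(𝓘) = 𝓘`. [folklore] -/
@[simp] theorem derivIdealSheafIter_zero (I : X.IdealSheafData) : derivIdealSheafIter φ 0 I = I :=
  rfl

/-- `𝒟^{i+1}(𝓘) = 𝒟(𝒟ⁱ(𝓘))`. [cite: BierstoneGrigorievMilmanWlodarczyk2011, Def. 3.5.1] -/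
theorem derivIdealSheafIter_succ (i : ℕ) (I : X.IdealSheafData) :
    derivIdealSheafIter φ (i + 1) I = derivIdealSheaf φ (derivIdealSheafIter φ i I) :=
  Function.iterate_succ_apply' _ _ _

/-- `𝓘 ⊆ 𝒟ⁱ(𝓘)`. [folklore] -/
theorem le_derivIdealSheafIter (i : ℕ) (I : X.IdealSheafData) : I ≤ derivIdealSheafIter φ i I := by
  induction i with
  | zero => exact le_rfl
  | succ i ih => rw [derivIdealSheafIter_succ]; exact ih.trans (le_derivIdealSheaf φ _)

/-- `𝒟ⁱ` is monotone in the ideal sheaf. [folklore] -/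
theorem derivIdealSheafIter_mono (i : ℕ) {I J : X.IdealSheafData} (h : I ≤ J) :
    derivIdealSheafIter φ i I ≤ derivIdealSheafIter φ i J := by
  induction i with
  | zero => exact h
  | succ i ih =>
    rw [derivIdealSheafIter_succ, derivIdealSheafIter_succ]
    exact derivIdealSheaf_mono φ ih

variable {φ}

/-- **Sections of `𝒟ⁱ(𝓘)`**: `𝒟ⁱ(𝓘)(U) = 𝒟ⁱ(𝓘(U))` for affine `U` (finitely presented
differentials). [cite: BierstoneGrigorievMilmanWlodarczyk2011, Def. 3.5.1] -/
theorem derivIdealSheafIter_ideal (hX : HasFinitePresentationDifferentials φ) (i : ℕ)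
    (I : X.IdealSheafData) (U : X.affineOpens) :
    (derivIdealSheafIter φ i I).ideal U =
      (letI := sectionsAlgebra φ U; derivIdealIter k i (I.ideal U)) := by
  induction i with
  | zero => rfl
  | succ i ih =>
    rw [derivIdealSheafIter_succ, derivIdealSheaf_ideal hX]
    letI := sectionsAlgebra φ U
    change derivIdeal k ((derivIdealSheafIter φ i I).ideal U) = derivIdealIter k (i + 1) (I.ideal U)
    rw [ih, derivIdealIter_succ]

/-! ## Stalks: `𝒟(𝓘)_x = 𝒟(𝓘_x)`, and the order drops by at most one -/

/-- **Stalks of the derivative ideal sheaf**: `𝒟(𝓘)_x = 𝒟(𝓘_x)`, the derivative ideal of the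
stalk `𝓘_x` in the `k`-algebra `𝒪_{X,x}` (finitely presented differentials; `𝒟` commutes with
the localization `Γ(X, U) → 𝒪_{X,x}`). [cite: BierstoneGrigorievMilmanWlodarczyk2011, Def. 3.5.1] -/
theorem stalkIdeal_derivIdealSheaf (hX : HasFinitePresentationDifferentials φ)
    (I : X.IdealSheafData) (x : X) :
    stalkIdeal (derivIdealSheaf φ I) x = (letI := stalkAlgebra φ x; derivIdeal k (stalkIdeal I x)) := by
  obtain ⟨U, hU, hxU, -⟩ :=
    exists_isAffineOpen_mem_and_subset (X := X) (x := x) (U := ⊤) (Opens.mem_top x)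
  letI := sectionsAlgebra φ U
  letI := stalkAlgebra φ x
  letI algx : Algebra Γ(X, U) (X.presheaf.stalk x) := (X.presheaf.germ U x hxU).hom.toAlgebra
  haveI : IsScalarTower k Γ(X, U) (X.presheaf.stalk x) :=
    IsScalarTower.of_algebraMap_eq fun c =>
      (RingHom.congr_fun (germ_comp_sectionsHom φ U x hxU) c).symm
  haveI : IsLocalization.AtPrime (X.presheaf.stalk x) (hU.primeIdealOf ⟨x, hxU⟩).asIdeal :=
    hU.isLocalization_stalk ⟨x, hxU⟩
  haveI := hX ⟨U, hU⟩
  rw [stalkIdeal_eq_map_germ _ ⟨U, hU⟩ hxU, stalkIdeal_eq_map_germ I ⟨U, hU⟩ hxU,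
    derivIdealSheaf_ideal hX]
  exact (derivIdeal_map_of_isLocalization k (X.presheaf.stalk x)
    (hU.primeIdealOf ⟨x, hxU⟩).asIdeal.primeCompl (I.ideal ⟨U, hU⟩)).symm

/-- **Stalks of `𝒟ⁱ(𝓘)`**: `𝒟ⁱ(𝓘)_x = 𝒟ⁱ(𝓘_x)`. [cite: BierstoneGrigorievMilmanWlodarczyk2011, Def. 3.5.1] -/
theorem stalkIdeal_derivIdealSheafIter (hX : HasFinitePresentationDifferentials φ) (i : ℕ)
    (I : X.IdealSheafData) (x : X) :
    stalkIdeal (derivIdealSheafIter φ i I) x =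
      (letI := stalkAlgebra φ x; derivIdealIter k i (stalkIdeal I x)) := by
  induction i with
  | zero => rfl
  | succ i ih =>
    rw [derivIdealSheafIter_succ, stalkIdeal_derivIdealSheaf hX]
    letI := stalkAlgebra φ x
    change derivIdeal k (stalkIdeal (derivIdealSheafIter φ i I) x) =
      derivIdealIter k (i + 1) (stalkIdeal I x)
    rw [ih, derivIdealIter_succ]

/-- **The order drops by at most one under `𝒟`**: `𝓘_x ⊆ 𝔪_xⁿ ⇒ 𝒟(𝓘)_x ⊆ 𝔪_xⁿ⁻¹` (Leibniz).
[cite: BierstoneGrigorievMilmanWlodarczyk2011, Lemma 3.5.2] -/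
theorem stalkIdeal_derivIdealSheaf_le_pow (hX : HasFinitePresentationDifferentials φ)
    {I : X.IdealSheafData} {x : X} {n : ℕ}
    (h : stalkIdeal I x ≤ maximalIdeal (X.presheaf.stalk x) ^ n) :
    stalkIdeal (derivIdealSheaf φ I) x ≤ maximalIdeal (X.presheaf.stalk x) ^ (n - 1) := by
  rw [stalkIdeal_derivIdealSheaf hX]
  letI := stalkAlgebra φ x
  exact derivIdeal_le_pow_sub_one k h

/-- **BGMW Lemma 3.5.2, `⊆`, at a point**: `𝓘_x ⊆ 𝔪_xⁿ ⇒ 𝒟ⁱ(𝓘)_x ⊆ 𝔪_xⁿ⁻ⁱ`, i.e.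
`ord_x 𝒟ⁱ(𝓘) ≥ ord_x 𝓘 - i` (every characteristic).
[cite: BierstoneGrigorievMilmanWlodarczyk2011, Lemma 3.5.2] -/
theorem stalkIdeal_derivIdealSheafIter_le_pow (hX : HasFinitePresentationDifferentials φ)
    {I : X.IdealSheafData} {x : X} {n : ℕ}
    (h : stalkIdeal I x ≤ maximalIdeal (X.presheaf.stalk x) ^ n) (i : ℕ) :
    stalkIdeal (derivIdealSheafIter φ i I) x ≤ maximalIdeal (X.presheaf.stalk x) ^ (n - i) := by
  rw [stalkIdeal_derivIdealSheafIter hX]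
  letI := stalkAlgebra φ x
  exact derivIdealIter_le_pow_sub k h i

/-- In terms of orders: `ord_x 𝓘 ≥ n ⇒ ord_x 𝒟ⁱ(𝓘) ≥ n - i`.
[cite: BierstoneGrigorievMilmanWlodarczyk2011, Lemma 3.5.2] -/
theorem le_idealOrder_derivIdealSheafIter (hX : HasFinitePresentationDifferentials φ)
    {I : X.IdealSheafData} {x : X} {n : ℕ} (h : (n : ℕ∞) ≤ idealOrder I x) (i : ℕ) :
    ((n - i : ℕ) : ℕ∞) ≤ idealOrder (derivIdealSheafIter φ i I) x := by
  rw [le_idealOrder_iff] at h ⊢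
  exact stalkIdeal_derivIdealSheafIter_le_pow hX h i

end Sheaf

/-! ## Marked ideals: `𝒟ⁱ(𝓘, μ) := (𝒟ⁱ(𝓘), μ - i)` and Lemma 3.5.2 `⊆` -/

namespace MarkedIdeal

variable {k : Type v} [CommRing k] {X : Scheme.{u}} (φ : k →+* Γ(X, ⊤))

/-- **The marked derivative `𝒟ⁱ(X, 𝓘, E, μ) := (X, 𝒟ⁱ(𝓘), E, μ - i)`** (BGMW Def. 3.5.1,
stated there for `i ≤ μ`; for `i > μ` the truncated subtraction gives multiplicity `0`).
[cite: BierstoneGrigorievMilmanWlodarczyk2011, Def. 3.5.1] -/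
def deriv (i : ℕ) (M : MarkedIdeal X) : MarkedIdeal X :=
  ⟨derivIdealSheafIter φ i M.ideal, M.boundary, M.mult - i⟩

/-- Unfolding `deriv`. [folklore] -/
@[simp] theorem deriv_ideal (i : ℕ) (M : MarkedIdeal X) :
    (M.deriv φ i).ideal = derivIdealSheafIter φ i M.ideal := rfl

/-- Unfolding `deriv`. [folklore] -/
@[simp] theorem deriv_boundary (i : ℕ) (M : MarkedIdeal X) : (M.deriv φ i).boundary = M.boundary :=
  rfl

/-- Unfolding `deriv`. [folklore] -/
@[simp] theorem deriv_mult (i : ℕ) (M : MarkedIdeal X) : (M.deriv φ i).mult = M.mult - i := rfl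

variable {φ}

/-- **BGMW Lemma 3.5.2, the inclusion `supp(𝓘, μ) ⊆ supp(𝒟ⁱ(𝓘), μ - i)`** (valid in every
characteristic and for every `i`; BGMW state equality for `0 ≤ i ≤ μ - 1` in characteristic zero,
resp. for `μ < p`, Thm. 8.0.4). [cite: BierstoneGrigorievMilmanWlodarczyk2011, Lemma 3.5.2] -/
theorem support_subset_support_deriv (hX : HasFinitePresentationDifferentials φ)
    (M : MarkedIdeal X) (i : ℕ) : M.support ⊆ (M.deriv φ i).support := by
  intro x hx
  rw [mem_support_iff] at hx ⊢
  exact stalkIdeal_derivIdealSheafIter_le_pow hX hx i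

end MarkedIdeal

end Literature.AlgebraicGeometry.Resolution
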